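import Literature.Probability.Percolation.KestenRelationRussoFromAltSeparation
import Literature.Probability.Percolation.KestenScalingThetaFromAltSeparation
import Literature.Probability.Percolation.AltFourArmStability
import Literature.Probability.Percolation.AltFourArmLowerBound
import HarnessLib

/-!
# `Werner2009_lemma62` from the two arm-separation displays alone (proofs only)

Topic `Literature/Probability/Percolation`; family `crit-perc`. PROOFS ONLY (no definition, no
named fact). Assembly, for the named fact `Literature.Probability.Percolation.Werner2009_lemma62`
(`KestenRelationRusso.lean`; W. Werner, *Lectures on two-dimensional critical percolation*,
IAS/Park City Math. Ser. 16 (2009), Lecture 6, Lemma 6.2 in the rhombus / two-sided form of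
P. Nolin, EJP 13 (2008), §7.3, proof of Prop. 34 and Remark 35 [arXiv 0711.4948: Prop. 32,
Remark 34]: `Σ_{x ∈ S_N} P_t(x pivotal for LR(S_N)) ≍ N² π₄(N)` uniformly for `p` near `1/2` and
`N ≤ L_ε(p)`), after `KestenRelationRussoFromAltSeparation.lean`.

That file proved the fact from FOUR displayed statements: `(hsepA)` near-critical separation of
four ALTERNATING arms, `c · π̂^alt_t(n, N) ≤ P_t(sepFourArm n N)` below `L(t, ε)` (Nolin 2008,
Thm. 11 for `j = 4`, `σ = BWBW` [arXiv Thm. 10]; Werner 2009, Prop. 6.1; Kesten 1987, Lemmas 4–6);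
`(hLB)` the a priori bound `c (m/n)^{2-β} ≤ π̂^alt_t(m, n)` below `L(t, ε)` (Werner 2009, Lecture 6,
§3, third estimate); `(hS)` Werner's Lemma 6.3 for `π̂^alt` (Nolin 2008, Thm. 27 for `σ = BWBW`);
and `(hLand)` the landing of the ADJACENT arrangement at `p = 1/2`,
`c · P_{1/2}(adjFourArm n N) ≤ P_{1/2}(landedFourAdj n N)` (Nolin 2008, Thm. 11 for `σ = BBWW` at
`p = 1/2`), which with Smirnov's colour switching (`fourArm_flip`, `FlipFourArm.lean`, PROVED)
bridges Werner's alternating `π̂` to the tree's order-free `π₄ = critFourArmProb` at `p = 1/2`.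
Two of the four are meanwhile THEOREMS of the tree:

* `(hLB)` is `altFourArm_lowerBound` (`AltFourArmLowerBound.lean`: the central five-arm site,
  Reimer's inequality and the a priori one-arm bound; no separation input);
* `(hS)` is `altFourArm_stability_of_altSeparation hsepA hLB` (`AltFourArmStability.lean`: Werner's
  §5 differential inequality for the landed alternating event, Russo and Grönwall).

Hence — this file —

* `altRhombusPivotal_of_altSeparation'` — **Werner's Lemma 6.2 for the rhombus in Werner's own
  (alternating) convention from `(hsepA)` ALONE**:
  `c N² π̂^alt_{1/2}(r₀, N) ≤ Σ_{v ∈ R(N,N)} P_t(v pivotal for LR(N, N)) ≤ C N² π̂^alt_{1/2}(r₀, N)`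
  for `t ∈ [1/2, 1/2 + δ)`, `n₁ ≤ N`, `N ≤ L(t, ε)` if `t > 1/2`, every small `ε`, every large `r₀`
  (`altRhombusPivotal_of_altSeparation` of `KestenScalingThetaFromAltSeparation.lean` with `(hLB)`,
  `(hS)` discharged);
* `Werner2009_lemma62_of_altSeparation_of_critBridge` — the tree's ORDER-FREE named fact from
  `(hsepA)` and the uniform critical bridge `c · π₄(n, N) ≤ π̂^alt_{1/2}(n, N)` (`n₀ ≤ n`, `2n ≤ N`;
  Nolin 2008, Prop. 20 for `j = 4`);
* `Werner2009_lemma62_of_altSeparation_of_landing` — **the named fact from the TWO arm-separation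
  displays `(hsepA)` and `(hLand)`** (the bridge being `fourArm_bridge_of_landing hLand`).

After this file the inputs of `Werner2009_lemma62_holds` are exactly Nolin's arm-separation
Thm. 11 for `j = 4` in the two colour arrangements: `σ = BWBW` below `L(p)` (to `sepFourArm`) and
`σ = BBWW` at `p = 1/2` (to `landedFourAdj`) — the targets of the tree's `ArmSeparation*At.lean` /
`AnnulusAlternation*.lean` programme. Everything here is proved; no `sorry`, no new definition, no
new named fact (D-0026).

## References

* W. Werner, *Lectures on two-dimensional critical percolation*, IAS/Park City Math. Ser. 16
  (2009), Lecture 6, §3 (a priori estimates), Prop. 6.1, Cor. 6.2, Lemma 6.2, Lemma 6.3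
  [arXiv 0710.0856, pp. 44–48] [WernerPCMI2009].
* P. Nolin, Near-critical percolation in two dimensions, *Electron. J. Probab.* 13 (2008)
  1562–1623, Thm. 11, §5.1 Prop. 20, Thm. 24 (ii), Thm. 27, §7.3 Prop. 34 and Remark 35
  (arXiv 0711.4948: Thm. 10, Prop. 19, Thm. 23 (ii), Thm. 26, Prop. 32, Remark 34) [Nolin2008].
* H. Kesten, Scaling relations for 2D-percolation, *Comm. Math. Phys.* 109 (1987) 109–156, (4.5)
  [KestenScalingCMP1987].
* B. Bollobás, O. Riordan, *Percolation*, CUP (2006), Ch. 7, Lemma 6 (colour switching)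
  [BollobasRiordan2006].

Tree: `Werner2009_lemma62_of_altSeparation_of_altLB_of_altStability_of_bridge`,
`Werner2009_lemma62_of_altSeparation_of_altLB_of_altStability_of_landing`
(`KestenRelationRussoFromAltSeparation.lean`), `altRhombusPivotal_of_altSeparation`
(`KestenScalingThetaFromAltSeparation.lean`), `altFourArm_lowerBound` (`AltFourArmLowerBound.lean`),
`altFourArm_stability_of_altSeparation` (`AltFourArmStability.lean`), `fourArm_bridge_of_landing`
(`FlipFourArm.lean`), `altFourArmProbAt`, `adjFourArm`, `landedFourAdj`, `sepFourArm`, `charLengthW`,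
`critFourArmProb`, `rhombusPivotalSum`.
-/

noncomputable section

open MeasureTheory Set
open scoped unitInterval

namespace Literature.Probability.Percolation

open LatticeModels

/-- **Werner's Lemma 6.2 for the rhombus, alternating convention, from alternating separation
alone.** IF `c · π̂^alt_t(n, N) ≤ P_t(sepFourArm n N)` uniformly below `L(t, ε)` (Nolin 2008,
Thm. 11 for `j = 4`, `σ = BWBW`), THEN for every small `ε` there is `r₁` such that for every
`r₀ ≥ r₁` there are `n₁`, `δ > 0`, `0 < c`, `C` with
`c N² π̂^alt_{1/2}(r₀, N) ≤ Σ_{v ∈ R(N, N)} P_t(v pivotal for LR(N, N)) ≤ C N² π̂^alt_{1/2}(r₀, N)` for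
`1/2 ≤ t < 1/2 + δ`, `n₁ ≤ N`, and `N ≤ L(t, ε)` if `t > 1/2`:
`altRhombusPivotal_of_altSeparation` with the a priori bound `altFourArm_lowerBound` and the
alternating Lemma 6.3 `altFourArm_stability_of_altSeparation`. This is Lemma 6.2 / Nolin's Remark 35
display with Werner's own `π̂` ("4 arms (open, closed, open, closed) ordered in this way",
arXiv 0710.0856 p. 38) at `p = 1/2` on the right-hand side. [cite: WernerPCMI2009, Lecture 6, Lemma 6.2 and Lemma 6.3 (arXiv 0710.0856 pp. 44–48)] [cite: Nolin2008, §7.3, proof of Prop. 34 and Remark 35; Thm. 11, Thm. 24 (ii), Thm. 27 (arXiv 0711.4948: Prop. 32, Remark 34, Thm. 10, Thm. 23 (ii), Thm. 26)] -/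
theorem altRhombusPivotal_of_altSeparation'
    (hsepA : ∃ ε₁ > (0 : ℝ), ∀ ⦃ε : ℝ⦄, 0 < ε → ε < ε₁ →
      ∃ n₀ : ℕ, ∃ δ > (0 : ℝ), ∃ c > (0 : ℝ),
        ∀ t : unitInterval, 1 / 2 ≤ (t : ℝ) → (t : ℝ) < 1 / 2 + δ →
          ∀ n N : ℕ, n₀ ≤ n → 2 * n ≤ N → (1 / 2 < (t : ℝ) → N ≤ charLengthW ε t) →
            c * altFourArmProbAt t n N ≤ (triSitePercolation t).real (sepFourArm n N)) :
    ∃ ε₁ > (0 : ℝ), ∀ ⦃ε : ℝ⦄, 0 < ε → ε < ε₁ →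
      ∃ r₁ : ℕ, ∀ r₀ ≥ r₁, ∃ n₁ : ℕ, ∃ δ > (0 : ℝ), ∃ c > (0 : ℝ), ∃ C : ℝ,
        ∀ t : unitInterval, 1 / 2 ≤ (t : ℝ) → (t : ℝ) < 1 / 2 + δ →
          ∀ N : ℕ, n₁ ≤ N → (1 / 2 < (t : ℝ) → N ≤ charLengthW ε t) →
            c * ((N : ℝ) ^ 2 * altFourArmProbAt half r₀ N) ≤ rhombusPivotalSum t N ∧
              rhombusPivotalSum t N ≤ C * ((N : ℝ) ^ 2 * altFourArmProbAt half r₀ N) :=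
  altRhombusPivotal_of_altSeparation hsepA altFourArm_lowerBound
    (altFourArm_stability_of_altSeparation hsepA altFourArm_lowerBound)

/-- **`Werner2009_lemma62` from alternating separation and the uniform critical bridge.** IF
`(hsepA)` and `c · π₄(n, N) ≤ π̂^alt_{1/2}(n, N)` for `n₀ ≤ n`, `2n ≤ N` (the order-free four-arm
probability at `p = 1/2` is dominated by the alternating one; Nolin 2008, Prop. 20 for `j = 4`
with Thm. 11 for `σ = BBWW`), THEN `Werner2009_lemma62`:
`Werner2009_lemma62_of_altSeparation_of_altLB_of_altStability_of_bridge` with `(hLB)`, `(hS)`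
discharged by `altFourArm_lowerBound` and `altFourArm_stability_of_altSeparation`. [cite: WernerPCMI2009, Lecture 6, §3, Prop. 6.1, Cor. 6.2, Lemma 6.2, Lemma 6.3] [cite: Nolin2008, Thm. 11, §5.1 Prop. 20, Thm. 24 (ii), Thm. 27, §7.3 Prop. 34 and Remark 35 (arXiv 0711.4948: Thm. 10, Prop. 19, Thm. 23 (ii), Thm. 26, Prop. 32, Remark 34)] -/
theorem Werner2009_lemma62_of_altSeparation_of_critBridge
    (hsepA : ∃ ε₁ > (0 : ℝ), ∀ ⦃ε : ℝ⦄, 0 < ε → ε < ε₁ →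
      ∃ n₀ : ℕ, ∃ δ > (0 : ℝ), ∃ c > (0 : ℝ),
        ∀ t : unitInterval, 1 / 2 ≤ (t : ℝ) → (t : ℝ) < 1 / 2 + δ →
          ∀ n N : ℕ, n₀ ≤ n → 2 * n ≤ N → (1 / 2 < (t : ℝ) → N ≤ charLengthW ε t) →
            c * altFourArmProbAt t n N ≤ (triSitePercolation t).real (sepFourArm n N))
    (hBr : ∃ c : ℝ, 0 < c ∧ ∃ n₀ : ℕ, ∀ n N : ℕ, n₀ ≤ n → 2 * n ≤ N →
      c * critFourArmProb n N ≤ (triSitePercolation half).real (altFourArm n N)) :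
    Werner2009_lemma62 :=
  Werner2009_lemma62_of_altSeparation_of_altLB_of_altStability_of_bridge hsepA altFourArm_lowerBound
    (altFourArm_stability_of_altSeparation hsepA altFourArm_lowerBound) hBr

/-- **`Werner2009_lemma62` from the two arm-separation displays.** IF `(hsepA)` — Nolin's Thm. 11
for `j = 4`, `σ = BWBW`, below `L(p)`: `c · π̂^alt_t(n, N) ≤ P_t(sepFourArm n N)` — and `(hLand)` —
Nolin's Thm. 11 for `σ = BBWW` at `p = 1/2`: `c · P_{1/2}(adjFourArm n N) ≤ P_{1/2}(landedFourAdj n N)`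
— THEN `Werner2009_lemma62`. The a priori bound is `altFourArm_lowerBound`, the alternating
Lemma 6.3 is `altFourArm_stability_of_altSeparation`, the critical bridge is
`fourArm_bridge_of_landing hLand` (Smirnov's colour switching, `fourArm_flip`). These two displays
are what remains for `Werner2009_lemma62_holds`. [cite: WernerPCMI2009, Lecture 6, §3, Prop. 6.1, Cor. 6.2, Lemma 6.2, Lemma 6.3] [cite: Nolin2008, Thm. 11, §5.1 Prop. 20, Thm. 24 (ii), Thm. 27, §7.3 Prop. 34 and Remark 35 (arXiv 0711.4948: Thm. 10, Prop. 19, Thm. 23 (ii), Thm. 26, Prop. 32, Remark 34)] [cite: BollobasRiordan2006, Ch. 7 Lemma 6] -/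
theorem Werner2009_lemma62_of_altSeparation_of_landing
    (hsepA : ∃ ε₁ > (0 : ℝ), ∀ ⦃ε : ℝ⦄, 0 < ε → ε < ε₁ →
      ∃ n₀ : ℕ, ∃ δ > (0 : ℝ), ∃ c > (0 : ℝ),
        ∀ t : unitInterval, 1 / 2 ≤ (t : ℝ) → (t : ℝ) < 1 / 2 + δ →
          ∀ n N : ℕ, n₀ ≤ n → 2 * n ≤ N → (1 / 2 < (t : ℝ) → N ≤ charLengthW ε t) →
            c * altFourArmProbAt t n N ≤ (triSitePercolation t).real (sepFourArm n N))
    (hLand : ∃ c : ℝ, 0 < c ∧ ∃ n₀ : ℕ, ∀ n N : ℕ, n₀ ≤ n → 2 * n ≤ N →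
      c * (triSitePercolation half).real (adjFourArm n N) ≤
        (triSitePercolation half).real (landedFourAdj n N)) :
    Werner2009_lemma62 :=
  Werner2009_lemma62_of_altSeparation_of_altLB_of_altStability_of_landing hsepA altFourArm_lowerBound
    (altFourArm_stability_of_altSeparation hsepA altFourArm_lowerBound) hLand

end Literature.Probability.Percolation

end
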